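import Literature.IUT.LogVolume.PilotSlotResidue
import Mathlib.Algebra.BigOperators.Ring.Finset
import Mathlib.Algebra.BigOperators.Group.Finset.Piecewise
import Mathlib.Tactic.Positivity
import Mathlib.Tactic.FieldSimp
import HarnessLib

/-!
# A closed-form lower bound for the (Ind1) slot residue at a prime that splits in `F_mod`

PROOF-ONLY sequel to `PilotSlotResidue.lean` (abc-iut cell, campaign-S seat abc-iut-S8). Dupuy–Hilado,
arXiv:2004.13228 [DupuyHilado2025]: §3.3 (`P_{Θ,j} = j²·P_q`), §3.6 (the weights `Pr(v) = n_v/[F:ℚ]`,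
`Σ_{v|p} Pr(v) = 1`, product weights on collections `v⃗ ∈ V(F)_p^{j+1}`), §4.7 ((Ind1) = permutations of the
tensor factors); S. Mochizuki, *IUT IV* [Mochizuki2012], Thm. 1.10 Step (v) p. 27–28; the cell's audit note
HOME/plan/c312/STEPV-IND1-NOTE.md §4 ("WHEN IT BITES (d_mod > 1)").

WHAT IS PROVED. Write `μ(v) := P_q(v)·ln|κ(v)|/n_v` (so `θ_j(v) = j²·μ(v)`, `slotValue_eq_sq_mul`) and
`w_v := Pr(v)`. For pilot data `X`, a finite index set `T`, a PRIME `p ∈ T` and ANY two places `v, v'` of `F`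
over `p`:
* `pair_defect_le_inner` — per procession index `j`: `w_v·w_{v'}·(θ_j(v) − θ_j(v')) ≤ Σ_{v⃗}(θ_j(v⃗(j)) −
  min_k θ_j(v⃗(k)))·Π_k w_{v⃗(k)}` (only the collections with `v⃗(0) = v'`, `v⃗(j) = v` are kept; their total
  weight is `w_{v'}·w_v` by independence of the slots, `sum_indicator_first_last_mul_prod_weight`);
* `slotResidue_ge_pair` — `w_v·w_{v'}·(1/ℓ⋇)Σ_j(θ_j(v) − θ_j(v')) ≤ slotResidue X T`;
* `slotResidue_ge_pair_closed` — in closed form: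
  **`w_v·w_{v'}·((ℓ⋇+1)(2ℓ⋇+1)/6)·(μ(v) − μ(v')) ≤ slotResidue X T`**, i.e. with `(ℓ⋇+1)(2ℓ⋇+1)/6 =
  ((l+1)/24)·(2l)·…` the SAME procession weight that produces [IUTchIV]'s `(l+1)/24` (`PilotDivisors.degLgp_thetaPilot`).
So at a prime `p` that splits in `F` into a bad place `v` (`μ(v) > 0`) and a place `v'` with smaller `μ` (e.g.
a good place, `μ(v') = 0`), the residue is at least the fraction `w_v·w_{v'}` of the `p`-part
`((ℓ⋇+1)(2ℓ⋇+1)/6)·μ(v)·w_v/…` of `deĝ̲_lgp(P_Θ)` — the quantitative content of STEPV-IND1-NOTE §4 at the level of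
the cell's typed definitions. Combined with `LDHSlotResidue.lean` (summit side): every hull-volume estimate
`δ` for a datum with such pilot data satisfies `δ ≥ w_v·w_{v'}·((ℓ⋇+1)(2ℓ⋇+1)/6)·(μ(v) − μ(v'))`.
Nothing here takes a side on [IUTchIII] Cor. 3.12; nothing is asserted about the existence of Θ-data; typed ≠
endorsed.
-/

noncomputable section

namespace Literature.IUT.LogVolume

open NumberField IsDedekindDomain Finset

namespace PilotData

variable {F : Type*} [Field F] [NumberField F] (X : PilotData F)

/-- `θ_j(v) = j²·μ(v)` with `μ(v) = P_q(v)·ln|κ(v)|/n_v` (`P_{Θ,j} = j²·P_q`, Dupuy–Hilado §3.3).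
[cite: DupuyHilado2025, §3.3] -/
theorem slotValue_eq_sq_mul (i : Fin X.lstar) (u : HeightOneSpectrum (𝓞 F)) :
    X.slotValue i u = (((i : ℕ) + 1 : ℝ) ^ 2) * (X.qPilot u * logNorm F u / (localDegree F u : ℝ)) := by
  rw [slotValue, thetaPilot_eq_smul, Finsupp.smul_apply, smul_eq_mul]
  ring

/-- Independence of the slots (two-coordinate marginal of the product weights): for weights `w` with
`Σ_s w(s) = 1` and distinct slots `a ≠ b`, `Σ_{e} f(e(a))·g(e(b))·Π_k w(e(k)) = (Σ_s f(s)w(s))·(Σ_s g(s)w(s))`.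
[folklore] -/
private theorem sum_mul_mul_prod_eq {S : Type*} [Fintype S] [DecidableEq S] (w : S → ℝ)
    (hw : ∑ s, w s = 1) {m : ℕ} (a b : Fin (m + 1)) (hab : a ≠ b) (f g : S → ℝ) :
    ∑ e : Fin (m + 1) → S, f (e a) * g (e b) * ∏ k, w (e k) =
      (∑ s, f s * w s) * (∑ s, g s * w s) := by
  have key : ∀ e : Fin (m + 1) → S, f (e a) * g (e b) * ∏ k, w (e k) =
      ∏ k, (w (e k) * (if k = a then f (e k) else 1) * (if k = b then g (e k) else 1)) := by
    intro e
    rw [Finset.prod_mul_distrib, Finset.prod_mul_distrib, Fintype.prod_ite_eq', Fintype.prod_ite_eq']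
    ring
  rw [Finset.sum_congr rfl (fun e _ => key e)]
  have hswap : ∑ e : Fin (m + 1) → S,
      ∏ k, (w (e k) * (if k = a then f (e k) else 1) * (if k = b then g (e k) else 1)) =
      ∏ k : Fin (m + 1), ∑ s : S, (w s * (if k = a then f s else 1) * (if k = b then g s else 1)) := by
    rw [Finset.prod_univ_sum, Fintype.piFinset_univ]
  rw [hswap]
  have hk : ∀ k : Fin (m + 1), ∑ s : S, (w s * (if k = a then f s else 1) * (if k = b then g s else 1)) =
      (if k = a then ∑ s, f s * w s else 1) * (if k = b then ∑ s, g s * w s else 1) := by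
    intro k
    by_cases hka : k = a
    · subst hka
      simp only [if_true, if_neg hab, mul_one]
      exact Finset.sum_congr rfl fun s _ => by ring
    · by_cases hkb : k = b
      · subst hkb
        simp only [hka, if_false, if_true, mul_one, one_mul]
        exact Finset.sum_congr rfl fun s _ => by ring
      · simp only [hka, hkb, if_false, mul_one]
        exact hw
  rw [Finset.prod_congr rfl (fun k _ => hk k), Finset.prod_mul_distrib, Fintype.prod_ite_eq',
    Fintype.prod_ite_eq']

/-- `Σ_{v|p} Pr(v) = 1` for a prime `p` (the fundamental identity `Σ n_v = [F:ℚ]`).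
[cite: DupuyHilado2025, §3.6] -/
theorem sum_weight_placesOver (p : ℕ) [Fact p.Prime] : ∑ v : placesOver F p, weight F v.1 = 1 :=
  (localWeights F p).sum_pr

open scoped Classical in
/-- **The weight of the collections with prescribed first and last slot**: for a prime `p`, degree
`j = i+1 ≥ 1` and places `v, v'` over `p`, `Σ_{v⃗ : v⃗(0) = v', v⃗(j) = v} Π_k Pr(v⃗(k)) = Pr(v')·Pr(v)` (written
with indicator functions). [cite: DupuyHilado2025, §3.6] -/
theorem sum_indicator_first_last_mul_prod_weight (p : ℕ) [Fact p.Prime] (i : ℕ)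
    (v v' : placesOver F p) :
    ∑ e : Fin (i + 1 + 1) → placesOver F p,
        (if e 0 = v' then (1 : ℝ) else 0) * (if e (Fin.last _) = v then (1 : ℝ) else 0) *
          ∏ k, weight F (e k).1 = weight F v'.1 * weight F v.1 := by
  classical
  have h0l : (0 : Fin (i + 1 + 1)) ≠ Fin.last _ := by
    intro h
    have := congrArg Fin.val h
    simp at this
  rw [sum_mul_mul_prod_eq (fun u : placesOver F p => weight F u.1) (sum_weight_placesOver p) 0 (Fin.last _)
    h0l (fun u => if u = v' then (1 : ℝ) else 0) (fun u => if u = v then (1 : ℝ) else 0)]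
  simp only [ite_mul, one_mul, zero_mul, Finset.sum_ite_eq', Finset.mem_univ, if_true]

/-- **Per procession index**: for a prime `p`, degree `j = i+1` and places `v, v'` over `p`,
`w_v·w_{v'}·(θ_j(v) − θ_j(v')) ≤ Σ_{v⃗∈V(F)_p^{j+1}} (θ_j(v⃗(j)) − min_k θ_j(v⃗(k)))·Π_k w_{v⃗(k)}`: keep only the
collections with `v⃗(0) = v'` and `v⃗(j) = v`, on which the defect is `≥ θ_j(v) − θ_j(v')` (the minimum sees
slot `0`); all other terms are nonnegative. [cite: DupuyHilado2025, §4.7] -/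
theorem pair_defect_le_inner (p : ℕ) [Fact p.Prime] (i : Fin X.lstar) (v v' : placesOver F p) :
    weight F v.1 * weight F v'.1 * (X.slotValue i v.1 - X.slotValue i v'.1) ≤
      ∑ e : Fin ((i : ℕ) + 1 + 1) → placesOver F p,
        (X.slotValue i (e (Fin.last _)).1
          - Finset.univ.inf' Finset.univ_nonempty (fun k => X.slotValue i (e k).1)) *
          ∏ k, weight F (e k).1 := by
  classical
  set c : ℝ := X.slotValue i v.1 - X.slotValue i v'.1 with hc
  calc weight F v.1 * weight F v'.1 * c
      = (∑ e : Fin ((i : ℕ) + 1 + 1) → placesOver F p,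
          (if e 0 = v' then (1 : ℝ) else 0) * (if e (Fin.last _) = v then (1 : ℝ) else 0) *
            ∏ k, weight F (e k).1) * c := by
        rw [sum_indicator_first_last_mul_prod_weight p i v v']; ring
    _ = ∑ e : Fin ((i : ℕ) + 1 + 1) → placesOver F p,
          (if e 0 = v' then (1 : ℝ) else 0) * (if e (Fin.last _) = v then (1 : ℝ) else 0) *
            (∏ k, weight F (e k).1) * c := Finset.sum_mul _ _ _
    _ ≤ _ := by
        refine Finset.sum_le_sum fun e _ => ?_
        have hw : 0 ≤ ∏ k, weight F (e k).1 := prod_weight_nonneg e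
        have hdef : 0 ≤ X.slotValue i (e (Fin.last _)).1
            - Finset.univ.inf' Finset.univ_nonempty (fun k => X.slotValue i (e k).1) :=
          sub_nonneg.mpr (Finset.inf'_le _ (Finset.mem_univ _))
        by_cases h0 : e 0 = v'
        · by_cases hl : e (Fin.last _) = v
          · rw [if_pos h0, if_pos hl, one_mul, one_mul, mul_comm]
            refine mul_le_mul_of_nonneg_right ?_ hw
            have hmin : Finset.univ.inf' Finset.univ_nonempty (fun k => X.slotValue i (e k).1) ≤
                X.slotValue i v'.1 := by
              rw [← h0]
              exact Finset.inf'_le _ (Finset.mem_univ _)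
            rw [hc, hl]
            linarith
          · rw [if_neg hl, mul_zero, zero_mul, zero_mul]
            exact mul_nonneg hdef hw
        · rw [if_neg h0, zero_mul, zero_mul, zero_mul]
          exact mul_nonneg hdef hw

/-- The inner collection sum of the residue at `(p, j)` is nonnegative. [cite: DupuyHilado2025, §4.7] -/
theorem inner_defect_sum_nonneg (p : ℕ) (i : Fin X.lstar) :
    0 ≤ ∑ e : Fin ((i : ℕ) + 1 + 1) → placesOver F p,
        (X.slotValue i (e (Fin.last _)).1
          - Finset.univ.inf' Finset.univ_nonempty (fun k => X.slotValue i (e k).1)) *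
          ∏ k, weight F (e k).1 :=
  Finset.sum_nonneg fun e _ =>
    mul_nonneg (sub_nonneg.mpr (Finset.inf'_le _ (Finset.mem_univ _))) (prod_weight_nonneg e)

/-- **Lower bound of the residue by one pair of places over one prime**: for a prime `p ∈ T` and places
`v, v'` over `p`, `w_v·w_{v'}·(1/ℓ⋇)Σ_j (θ_j(v) − θ_j(v')) ≤ slotResidue X T`.
[cite: DupuyHilado2025, §4.7] -/
theorem slotResidue_ge_pair (T : Finset ℕ) {p : ℕ} [Fact p.Prime] (hp : p ∈ T) (v v' : placesOver F p) :
    weight F v.1 * weight F v'.1 *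
        ((1 / (X.lstar : ℝ)) * ∑ i : Fin X.lstar, (X.slotValue i v.1 - X.slotValue i v'.1)) ≤
      X.slotResidue T := by
  classical
  rw [slotResidue_eq_sum]
  have hl : (0 : ℝ) ≤ 1 / (X.lstar : ℝ) := by positivity
  calc weight F v.1 * weight F v'.1 *
        ((1 / (X.lstar : ℝ)) * ∑ i : Fin X.lstar, (X.slotValue i v.1 - X.slotValue i v'.1))
      = (1 / (X.lstar : ℝ)) * ∑ i : Fin X.lstar,
          weight F v.1 * weight F v'.1 * (X.slotValue i v.1 - X.slotValue i v'.1) := by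
        rw [← Finset.mul_sum]; ring
    _ ≤ (1 / (X.lstar : ℝ)) * ∑ i : Fin X.lstar, ∑ e : Fin ((i : ℕ) + 1 + 1) → placesOver F p,
          (X.slotValue i (e (Fin.last _)).1
            - Finset.univ.inf' Finset.univ_nonempty (fun k => X.slotValue i (e k).1)) *
            ∏ k, weight F (e k).1 :=
        mul_le_mul_of_nonneg_left (Finset.sum_le_sum fun i _ => X.pair_defect_le_inner p i v v') hl
    _ ≤ _ := by
        refine Finset.single_le_sum (f := fun p => (1 / (X.lstar : ℝ)) * ∑ i : Fin X.lstar,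
          ∑ e : Fin ((i : ℕ) + 1 + 1) → placesOver F p,
            (X.slotValue i (e (Fin.last _)).1
              - Finset.univ.inf' Finset.univ_nonempty (fun k => X.slotValue i (e k).1)) *
              ∏ k, weight F (e k).1) (fun q _ => ?_) hp
        exact mul_nonneg hl (Finset.sum_nonneg fun i _ => X.inner_defect_sum_nonneg q i)

/-- Plumbing: `Σ_{i<n} (i+1)² = n(n+1)(2n+1)/6` over `ℝ`. [folklore] -/
private theorem sum_succ_sq' (n : ℕ) :
    ∑ i ∈ range n, (((i : ℕ) : ℝ) + 1) ^ 2 = (n : ℝ) * (n + 1) * (2 * n + 1) / 6 := by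
  induction n with
  | zero => simp
  | succ n ih =>
    rw [Finset.sum_range_succ, ih]
    push_cast
    ring

/-- The procession average of the squares: `(1/ℓ⋇)·Σ_{j=1}^{ℓ⋇} j² = (ℓ⋇+1)(2ℓ⋇+1)/6` — [IUTchIV] Thm. 1.10
Step (i) (E2). [cite: Mochizuki2012, IUTchIV Thm. 1.10 Step (i) p. 23] -/
theorem procAvg_sq : (1 / (X.lstar : ℝ)) * ∑ i : Fin X.lstar, (((i : ℕ) + 1 : ℝ) ^ 2) =
    ((X.lstar : ℝ) + 1) * (2 * X.lstar + 1) / 6 := by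
  have hn : (X.lstar : ℝ) ≠ 0 := by
    have := X.two_le_lstar; exact_mod_cast (by omega : X.lstar ≠ 0)
  rw [Fin.sum_univ_eq_sum_range (fun i => ((i : ℝ) + 1) ^ 2) X.lstar, sum_succ_sq']
  field_simp

/-- **Closed form**: for a prime `p ∈ T` and places `v, v'` of `F` over `p`,
`w_v·w_{v'}·((ℓ⋇+1)(2ℓ⋇+1)/6)·(μ(v) − μ(v')) ≤ slotResidue X T`, `μ(u) = P_q(u)·ln|κ(u)|/n_u`,
`w_u = Pr(u) = n_u/[F:ℚ]`. At a prime split in `F` into a bad place `v` and a good place `v'` (`μ(v') = 0`) the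
(Ind1) slot residue is at least `w_v·w_{v'}` times the procession weight `(ℓ⋇+1)(2ℓ⋇+1)/6` times `μ(v)` — the
kernel form of STEPV-IND1-NOTE §4 "WHEN IT BITES". [cite: Mochizuki2012, IUTchIV Thm. 1.10 Step (v) p. 27–28] -/
theorem slotResidue_ge_pair_closed (T : Finset ℕ) {p : ℕ} [Fact p.Prime] (hp : p ∈ T)
    (v v' : placesOver F p) :
    weight F v.1 * weight F v'.1 * (((X.lstar : ℝ) + 1) * (2 * X.lstar + 1) / 6) *
        (X.qPilot v.1 * logNorm F v.1 / (localDegree F v.1 : ℝ)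
          - X.qPilot v'.1 * logNorm F v'.1 / (localDegree F v'.1 : ℝ)) ≤
      X.slotResidue T := by
  have h := X.slotResidue_ge_pair T hp v v'
  have hsum : (1 / (X.lstar : ℝ)) * ∑ i : Fin X.lstar, (X.slotValue i v.1 - X.slotValue i v'.1) =
      (((X.lstar : ℝ) + 1) * (2 * X.lstar + 1) / 6) *
        (X.qPilot v.1 * logNorm F v.1 / (localDegree F v.1 : ℝ)
          - X.qPilot v'.1 * logNorm F v'.1 / (localDegree F v'.1 : ℝ)) := by
    simp only [slotValue_eq_sq_mul, ← mul_sub]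
    rw [← Finset.sum_mul, ← mul_assoc, procAvg_sq]
  rw [hsum, ← mul_assoc] at h
  exact h

end PilotData

end Literature.IUT.LogVolume

end
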